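import Summits.SmoothPoincare4.SmoothPoincare4.Theorems.WeakReductionDescentDependentTripleGenusThreeStandard
import Summits.SmoothPoincare4.SmoothPoincare4.Theorems.WeakReductionDescentGenusThreeBaseDichotomy
import Summits.SmoothPoincare4.SmoothPoincare4.Theorems.WeakReductionDescentMinimalWeaklyReducibleOfRungs
import Summits.SmoothPoincare4.SmoothPoincare4.Theorems.WeakReductionDescentTrisectionsExist

/-!
# SmoothPoincare4 / WeakReductionDescent — what `DependentTripleGenusThreeStandard` owes beyond the
route's own items: the weak-reduction alternative of Aranda–Zupan §7

Item stmt-SmoothPoincare4-18000 (`DependentTripleGenusThreeStandard`, X_F of the rung split of the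
crux `MinimalWeaklyReducible`) is, kernel-checked (`dependentTripleGenusThreeStandard_iff_arandaZupan`,
sibling file `WeakReductionDescentDependentTripleGenusThreeStandard.lean`, `Iff.rfl`), the unproved
named fact `Literature.Topology.FourManifolds.arandaZupan_dependentTriple_genusThree_homotopySphere`
— the homotopy-sphere corollary of the WHOLE of Aranda–Zupan 2025, Thm. 1.4 (arXiv:2503.04607,
p. 2): "Suppose a genus-three trisection `T` of `X` admits a dependent triple. Then either `T` is
reducible, or `T` contains a five-chain. In particular, `X` is diffeomorphic to a spun lens space
`S_p` or its sibling `S'_p`, `S⁴`, or a connected sum of copies of `±ℂP²`, `S¹ × S³`, and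
`S² × S²`."

The printed PROOF (§7, pp. 25–26) is short and runs THROUGH Thm. 1.3: of the three configurations
of a dependent triple `(α₁, β₁, γ₁)` on the genus-`3` surface (p. 24, Fig. 18) — (1) two curves
homotopic, (2) two curves homologous but not homotopic, (3) the triple cobounds a pair of pants —
cases (1), (2) (via Lemma 3.8 applied to `H_β ∪ H_γ`) and the sub-case of (3) in which one of the
curves bounds a disc in a second handlebody all make `T` WEAKLY REDUCIBLE ("and we apply Theorem
1.3"), while the remaining sub-case of (3) produces, by Lemma 3.7 twice and handle slides, a
five-chain `{γ₁, β₂, α₁, γ₂*, β₁}` (Fig. 19), whence by Lemma 5.4, Prop. 5.5, [MZ17b] and Lemma 7.1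
`X` is `S_p`, `S'_p` (`p ≥ 1`; `S_1 = S'_1 = S⁴`, §2 p. 7) or a connected sum of copies of `±ℂP²`
and `S² × S²` — among which the only homotopy 4-sphere is `S⁴` (`π₁ = 1`, `H₂ = 0`).

The route ALREADY carries the homotopy-sphere corollary of Thm. 1.3 as its item `GenusThreeBase`
(stmt-SmoothPoincare4-17910), and the reducible branch of both theorems as `ReducibleSplits`
(stmt-17909) + `LowGenusBase` (stmt-17911) + the PROVED `SphereSumSphere`.  This file records,
kernel-checked and WITHOUT introducing any named fact or definition, what X_F costs on top of those
items, in the tree's vocabulary `Literature.Topology.FourManifolds.Trisection.IsCurve / BoundsDisc /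
IsNonSeparating / IsWeaklyReducible / IsReducible` (which unfold by `rfl` to the route's
`let`-blocks):

  `(W)  ∀ M (bare binders), M ≃ₕ S⁴ → ∀ k T, IsGKTrisection M 3 k T → DependentTriple T →
          IsWeaklyReducible T ∨ Nonempty (M ≅ S⁴)`      — §7 minus Thm. 1.3, homotopy-sphere form;
  `(D)  … → DependentTriple T → IsReducible T ∨ Nonempty (M ≅ S⁴)` — Thm. 1.4, first sentence,
          plus the non-reducible (five-chain) branch, homotopy-sphere form.

* `dependentTripleGenusThreeStandard_of_isWeaklyReducible_or` — `(W) → GenusThreeBase → X_F`;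
  `isWeaklyReducible_or_of_dependentTripleGenusThreeStandard` — conversely `X_F → (W)`.  So MODULO
  the route item `GenusThreeBase` the item X_F is EQUIVALENT to `(W)`: Thm. 1.3 is not owed twice.
* `dependentTripleGenusThreeStandard_of_isReducible_or` — `(D) → ReducibleSplits → LowGenusBase →
  X_F` (as `genusThreeBase_of_isReducible_or` does for Thm. 1.3);
  `isReducible_or_of_dependentTripleGenusThreeStandard` — conversely.
* `isWeaklyReducible_or_of_arandaZupan_dependentTriple`, `isReducible_or_of_arandaZupan_dependentTriple`
  — the vendored fact gives `(W)` and `(D)` (nothing here is stronger than what the tree assumes).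
* `minimalWeaklyReducible_of_isWeaklyReducible_or` — with `(W)` in place of X_F the glue of the rung
  split is DIRECT: a minimal genus-`3` GK-trisection of a homotopy sphere carries a dependent triple
  (X₁ `DependentTripleAtThree`), hence by `(W)` is weakly reducible or `M ≅ S⁴`, and the latter
  contradicts minimality (`not_minimalGenus_of_diffeomorph_sphere`, PROVED); so
  `(W) → DependentTripleAtThree → MinimalWeaklyReducibleFromFour → MinimalWeaklyReducible`, and
  `smoothPoincare4_of_isWeaklyReducible_or` — the route's deciding theorem `closes` goes through with
  `(W)` replacing X_F (the proved items `TrisectionsExist`, `SphereSumSphere`, and the glue discharged).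

All seven are `--supports` helpers for stmt-SmoothPoincare4-18000; the item itself stays closed
MODULO the named fact (its unconditional close is the discharge `…_holds`, absent from the tree:
`(W)` needs Lemmas 3.7/3.8 (thin position, [CG87, ST94]), handle slides, five-chain surgery (§5),
[MZ17b] and the correspondence trisection diagrams ↔ `IsGKTrisection`, none of it in the tree).
-/

-- the registered namespace `Summit.SmoothPoincare4.SmoothPoincare4.Theorems` repeats a component
set_option linter.dupNamespace false

namespace Summit.SmoothPoincare4.SmoothPoincare4.Theorems

open scoped Manifold ContDiff ContinuousMap
open Summit.SmoothPoincare4.SmoothPoincare4.Theses.WeakReductionDescent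
open Literature.Topology.FourManifolds Literature.Topology.FourManifolds.Trisection

/-! ### X_F modulo `GenusThreeBase`: the weak-reduction alternative `(W)` -/

/-- **X_F from `GenusThreeBase` and the weak-reduction alternative `(W)`.**  If every genus-`3`
GK-trisection of a smooth homotopy 4-sphere `M` that admits a dependent triple (pairwise disjoint
non-separating curves `a ⊂ H 0`-disc, `b ⊂ H 1`-disc, `c ⊂ H 2`-disc whose union separates the
central surface — the route's `let`-block, spelled with the tree's `Trisection` vocabulary) is
weakly reducible unless `M ≅ S⁴` (hypothesis `hW`: Aranda–Zupan §7, cases (1), (2), (3) of the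
proof of Thm. 1.4 — weak reducibility in cases (1), (2) and the first sub-case of (3), a five-chain
and hence `S_p`, `S'_p` or sums of `±ℂP²`, `S² × S²` in the last sub-case, of which only `S⁴` is a
homotopy sphere), then `DependentTripleGenusThreeStandard` follows from the route item
`GenusThreeBase` (the homotopy-sphere corollary of Thm. 1.3).  Conditional on `hW` and on the item
(D-0014). [cite: ArandaZupan2025, Thm. 1.4 (p. 2) and its proof, §7 (pp. 24–26)] -/
theorem dependentTripleGenusThreeStandard_of_isWeaklyReducible_or
    (hW : ∀ (M : Type) [TopologicalSpace M] [T2Space M] [SecondCountableTopology M]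
      [ChartedSpace (EuclideanSpace ℝ (Fin 4)) M] [IsManifold (𝓡 4) ((⊤ : ℕ∞) : WithTop ℕ∞) M],
      (M ≃ₕ (Metric.sphere (0 : EuclideanSpace ℝ (Fin 5)) 1)) → ∀ (k : Fin 3 → ℕ) (T : Fin 3 → Set M),
      IsGKTrisection M 3 k T →
      (∃ (a b c : Set M), IsCurve T a ∧ IsCurve T b ∧ IsCurve T c ∧ Disjoint a b ∧ Disjoint b c ∧
        Disjoint a c ∧ IsNonSeparating T a ∧ IsNonSeparating T b ∧ IsNonSeparating T c ∧
        BoundsDisc T (spineHandlebody T 0) a ∧ BoundsDisc T (spineHandlebody T 1) b ∧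
        BoundsDisc T (spineHandlebody T 2) c ∧
        ¬ IsPreconnected (centralSurfaceSet T \ (a ∪ b ∪ c))) →
      IsWeaklyReducible T ∨ Nonempty (Diffeomorph (𝓡 4) (𝓡 4) M
        (Metric.sphere (0 : EuclideanSpace ℝ (Fin 5)) 1) ((⊤ : ℕ∞) : WithTop ℕ∞)))
    (h4 : GenusThreeBase) : DependentTripleGenusThreeStandard := by
  unfold DependentTripleGenusThreeStandard
  intro M _ _ _ _ _ e k T hT hdt
  rcases hW M e k T hT hdt with hwr | hdiff
  · exact h4 M e k T hT hwr
  · exact hdiff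

/-- **Conversely, X_F gives the weak-reduction alternative `(W)`** (its second disjunct), so that
MODULO the route item `GenusThreeBase` the item `DependentTripleGenusThreeStandard` is equivalent to
`(W)` — the homotopy-sphere content of §7 of Aranda–Zupan over and above Thm. 1.3.
[cite: ArandaZupan2025, Thm. 1.4 (p. 2), §7 (pp. 25–26)] -/
theorem isWeaklyReducible_or_of_dependentTripleGenusThreeStandard
    (h : DependentTripleGenusThreeStandard) :
    ∀ (M : Type) [TopologicalSpace M] [T2Space M] [SecondCountableTopology M]
      [ChartedSpace (EuclideanSpace ℝ (Fin 4)) M] [IsManifold (𝓡 4) ((⊤ : ℕ∞) : WithTop ℕ∞) M],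
      (M ≃ₕ (Metric.sphere (0 : EuclideanSpace ℝ (Fin 5)) 1)) → ∀ (k : Fin 3 → ℕ) (T : Fin 3 → Set M),
      IsGKTrisection M 3 k T →
      (∃ (a b c : Set M), IsCurve T a ∧ IsCurve T b ∧ IsCurve T c ∧ Disjoint a b ∧ Disjoint b c ∧
        Disjoint a c ∧ IsNonSeparating T a ∧ IsNonSeparating T b ∧ IsNonSeparating T c ∧
        BoundsDisc T (spineHandlebody T 0) a ∧ BoundsDisc T (spineHandlebody T 1) b ∧
        BoundsDisc T (spineHandlebody T 2) c ∧
        ¬ IsPreconnected (centralSurfaceSet T \ (a ∪ b ∪ c))) →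
      IsWeaklyReducible T ∨ Nonempty (Diffeomorph (𝓡 4) (𝓡 4) M
        (Metric.sphere (0 : EuclideanSpace ℝ (Fin 5)) 1) ((⊤ : ℕ∞) : WithTop ℕ∞)) := by
  intro M _ _ _ _ _ e k T hT hdt
  exact Or.inr (h M e k T hT hdt)

/-- **The vendored fact gives `(W)`**: from
`Literature.Topology.FourManifolds.arandaZupan_dependentTriple_genusThree_homotopySphere` (AZ25
Thm. 1.4 / Cor. 1.5, homotopy-sphere corollary) the weak-reduction alternative follows (through
`dependentTripleGenusThreeStandard_of_arandaZupan`), so the hypothesis `hW` of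
`dependentTripleGenusThreeStandard_of_isWeaklyReducible_or` is at most as strong as what the tree
already assumes for this item. [cite: ArandaZupan2025, Thm. 1.4 and Cor. 1.5 (p. 2)] -/
theorem isWeaklyReducible_or_of_arandaZupan_dependentTriple
    (hAZ : Literature.Topology.FourManifolds.arandaZupan_dependentTriple_genusThree_homotopySphere) :
    ∀ (M : Type) [TopologicalSpace M] [T2Space M] [SecondCountableTopology M]
      [ChartedSpace (EuclideanSpace ℝ (Fin 4)) M] [IsManifold (𝓡 4) ((⊤ : ℕ∞) : WithTop ℕ∞) M],
      (M ≃ₕ (Metric.sphere (0 : EuclideanSpace ℝ (Fin 5)) 1)) → ∀ (k : Fin 3 → ℕ) (T : Fin 3 → Set M),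
      IsGKTrisection M 3 k T →
      (∃ (a b c : Set M), IsCurve T a ∧ IsCurve T b ∧ IsCurve T c ∧ Disjoint a b ∧ Disjoint b c ∧
        Disjoint a c ∧ IsNonSeparating T a ∧ IsNonSeparating T b ∧ IsNonSeparating T c ∧
        BoundsDisc T (spineHandlebody T 0) a ∧ BoundsDisc T (spineHandlebody T 1) b ∧
        BoundsDisc T (spineHandlebody T 2) c ∧
        ¬ IsPreconnected (centralSurfaceSet T \ (a ∪ b ∪ c))) →
      IsWeaklyReducible T ∨ Nonempty (Diffeomorph (𝓡 4) (𝓡 4) M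
        (Metric.sphere (0 : EuclideanSpace ℝ (Fin 5)) 1) ((⊤ : ℕ∞) : WithTop ℕ∞)) :=
  isWeaklyReducible_or_of_dependentTripleGenusThreeStandard
    (dependentTripleGenusThreeStandard_of_arandaZupan hAZ)

/-! ### X_F modulo `ReducibleSplits` + `LowGenusBase`: the dichotomy `(D)` of Thm. 1.4 -/

/-- **X_F from the Aranda–Zupan dichotomy `(D)` and the route's descent items.**  If every
genus-`3` GK-trisection of a smooth homotopy 4-sphere `M` admitting a dependent triple is
reducible unless `M ≅ S⁴` (hypothesis `hD`: Thm. 1.4, first sentence "either `T` is reducible, or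
`T` contains a five-chain", with the five-chain branch of its proof, §7 p. 26: `S_p`, `S'_p` or sums
of `±ℂP²`, `S² × S²`, of which only `S⁴` is a homotopy sphere), then
`DependentTripleGenusThreeStandard` follows from the route items `ReducibleSplits` (a reducible
genus-`g` trisection of a homotopy sphere splits it as `A # B`, homotopy spheres trisected with
genera `< g`) and `LowGenusBase` (genus `≤ 2` ⇒ `≅ S⁴`), the last step `S⁴ # S⁴ ≅ S⁴` being the
PROVED item `SphereSumSphere_proof` — exactly as `genusThreeBase_of_isReducible_or` does for Thm. 1.3.
Conditional on `hD` and on the two items (D-0014).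
[cite: ArandaZupan2025, Thm. 1.4 (p. 2), §7 (pp. 25–26)] -/
theorem dependentTripleGenusThreeStandard_of_isReducible_or
    (hD : ∀ (M : Type) [TopologicalSpace M] [T2Space M] [SecondCountableTopology M]
      [ChartedSpace (EuclideanSpace ℝ (Fin 4)) M] [IsManifold (𝓡 4) ((⊤ : ℕ∞) : WithTop ℕ∞) M],
      (M ≃ₕ (Metric.sphere (0 : EuclideanSpace ℝ (Fin 5)) 1)) → ∀ (k : Fin 3 → ℕ) (T : Fin 3 → Set M),
      IsGKTrisection M 3 k T →
      (∃ (a b c : Set M), IsCurve T a ∧ IsCurve T b ∧ IsCurve T c ∧ Disjoint a b ∧ Disjoint b c ∧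
        Disjoint a c ∧ IsNonSeparating T a ∧ IsNonSeparating T b ∧ IsNonSeparating T c ∧
        BoundsDisc T (spineHandlebody T 0) a ∧ BoundsDisc T (spineHandlebody T 1) b ∧
        BoundsDisc T (spineHandlebody T 2) c ∧
        ¬ IsPreconnected (centralSurfaceSet T \ (a ∪ b ∪ c))) →
      IsReducible T ∨ Nonempty (Diffeomorph (𝓡 4) (𝓡 4) M
        (Metric.sphere (0 : EuclideanSpace ℝ (Fin 5)) 1) ((⊤ : ℕ∞) : WithTop ℕ∞)))
    (h3 : ReducibleSplits) (h5 : LowGenusBase) : DependentTripleGenusThreeStandard := by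
  unfold DependentTripleGenusThreeStandard
  intro M _ _ _ _ _ e k T hT hdt
  rcases hD M e k T hT hdt with hred | hdiff
  · obtain ⟨A, _, _, _, _, _, eA, B, _, _, _, _, _, eB, ga, gb, ka, kb, TA, TB, hA, hB, hga, hgb,
      hsum⟩ := h3 M e 3 k T hT hred
    exact SphereSumSphere_proof A B M hsum (h5 A eA ga ka TA hA (by omega))
      (h5 B eB gb kb TB hB (by omega))
  · exact hdiff

/-- **Conversely, X_F gives the dichotomy `(D)`** (its second disjunct), so that MODULO the route
items `ReducibleSplits` and `LowGenusBase` the item is equivalent to the homotopy-sphere form of the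
Thm. 1.4 dichotomy. [cite: ArandaZupan2025, Thm. 1.4 (p. 2)] -/
theorem isReducible_or_of_dependentTripleGenusThreeStandard (h : DependentTripleGenusThreeStandard) :
    ∀ (M : Type) [TopologicalSpace M] [T2Space M] [SecondCountableTopology M]
      [ChartedSpace (EuclideanSpace ℝ (Fin 4)) M] [IsManifold (𝓡 4) ((⊤ : ℕ∞) : WithTop ℕ∞) M],
      (M ≃ₕ (Metric.sphere (0 : EuclideanSpace ℝ (Fin 5)) 1)) → ∀ (k : Fin 3 → ℕ) (T : Fin 3 → Set M),
      IsGKTrisection M 3 k T →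
      (∃ (a b c : Set M), IsCurve T a ∧ IsCurve T b ∧ IsCurve T c ∧ Disjoint a b ∧ Disjoint b c ∧
        Disjoint a c ∧ IsNonSeparating T a ∧ IsNonSeparating T b ∧ IsNonSeparating T c ∧
        BoundsDisc T (spineHandlebody T 0) a ∧ BoundsDisc T (spineHandlebody T 1) b ∧
        BoundsDisc T (spineHandlebody T 2) c ∧
        ¬ IsPreconnected (centralSurfaceSet T \ (a ∪ b ∪ c))) →
      IsReducible T ∨ Nonempty (Diffeomorph (𝓡 4) (𝓡 4) M
        (Metric.sphere (0 : EuclideanSpace ℝ (Fin 5)) 1) ((⊤ : ℕ∞) : WithTop ℕ∞)) := by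
  intro M _ _ _ _ _ e k T hT hdt
  exact Or.inr (h M e k T hT hdt)

/-- **The vendored fact gives `(D)`** (through `dependentTripleGenusThreeStandard_of_arandaZupan`).
[cite: ArandaZupan2025, Thm. 1.4 and Cor. 1.5 (p. 2)] -/
theorem isReducible_or_of_arandaZupan_dependentTriple
    (hAZ : Literature.Topology.FourManifolds.arandaZupan_dependentTriple_genusThree_homotopySphere) :
    ∀ (M : Type) [TopologicalSpace M] [T2Space M] [SecondCountableTopology M]
      [ChartedSpace (EuclideanSpace ℝ (Fin 4)) M] [IsManifold (𝓡 4) ((⊤ : ℕ∞) : WithTop ℕ∞) M],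
      (M ≃ₕ (Metric.sphere (0 : EuclideanSpace ℝ (Fin 5)) 1)) → ∀ (k : Fin 3 → ℕ) (T : Fin 3 → Set M),
      IsGKTrisection M 3 k T →
      (∃ (a b c : Set M), IsCurve T a ∧ IsCurve T b ∧ IsCurve T c ∧ Disjoint a b ∧ Disjoint b c ∧
        Disjoint a c ∧ IsNonSeparating T a ∧ IsNonSeparating T b ∧ IsNonSeparating T c ∧
        BoundsDisc T (spineHandlebody T 0) a ∧ BoundsDisc T (spineHandlebody T 1) b ∧
        BoundsDisc T (spineHandlebody T 2) c ∧
        ¬ IsPreconnected (centralSurfaceSet T \ (a ∪ b ∪ c))) →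
      IsReducible T ∨ Nonempty (Diffeomorph (𝓡 4) (𝓡 4) M
        (Metric.sphere (0 : EuclideanSpace ℝ (Fin 5)) 1) ((⊤ : ℕ∞) : WithTop ℕ∞)) :=
  isReducible_or_of_dependentTripleGenusThreeStandard
    (dependentTripleGenusThreeStandard_of_arandaZupan hAZ)

/-! ### `(W)` in the route: the glue becomes direct and `closes` goes through -/

/-- **With `(W)` the rung split of the crux `MinimalWeaklyReducible` glues DIRECTLY.**  The proved
glue `MinimalWeaklyReducibleOfRungs_proof` uses X_F at `g = 3` to make the rung VACUOUS (`M ≅ S⁴`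
contradicts minimality).  With the weak-reduction alternative `(W)` instead, rung `3` is Aranda–Zupan's
own mechanism: a minimal genus-`3` GK-trisection `T` of a smooth homotopy 4-sphere `M` carries a
dependent triple (X₁, `DependentTripleAtThree`), so by `(W)` either `T` is weakly reducible — the
claim — or `M ≅ S⁴`, which is impossible for a minimal genus `≥ 1`
(`not_minimalGenus_of_diffeomorph_sphere`: the genus-`0` trisection of the round sphere pulls back);
at `g ≥ 4` the rung is X₂ (`MinimalWeaklyReducibleFromFour`) verbatim.
[cite: ArandaZupan2025, §7 (pp. 25–26)] [cite: GayKirby2016, §2 (first example)] -/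
theorem minimalWeaklyReducible_of_isWeaklyReducible_or
    (hW : ∀ (M : Type) [TopologicalSpace M] [T2Space M] [SecondCountableTopology M]
      [ChartedSpace (EuclideanSpace ℝ (Fin 4)) M] [IsManifold (𝓡 4) ((⊤ : ℕ∞) : WithTop ℕ∞) M],
      (M ≃ₕ (Metric.sphere (0 : EuclideanSpace ℝ (Fin 5)) 1)) → ∀ (k : Fin 3 → ℕ) (T : Fin 3 → Set M),
      IsGKTrisection M 3 k T →
      (∃ (a b c : Set M), IsCurve T a ∧ IsCurve T b ∧ IsCurve T c ∧ Disjoint a b ∧ Disjoint b c ∧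
        Disjoint a c ∧ IsNonSeparating T a ∧ IsNonSeparating T b ∧ IsNonSeparating T c ∧
        BoundsDisc T (spineHandlebody T 0) a ∧ BoundsDisc T (spineHandlebody T 1) b ∧
        BoundsDisc T (spineHandlebody T 2) c ∧
        ¬ IsPreconnected (centralSurfaceSet T \ (a ∪ b ∪ c))) →
      IsWeaklyReducible T ∨ Nonempty (Diffeomorph (𝓡 4) (𝓡 4) M
        (Metric.sphere (0 : EuclideanSpace ℝ (Fin 5)) 1) ((⊤ : ℕ∞) : WithTop ℕ∞)))
    (h₁ : DependentTripleAtThree) (h₂ : MinimalWeaklyReducibleFromFour) : MinimalWeaklyReducible := by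
  unfold MinimalWeaklyReducible
  intro M _ _ _ _ _ e g k T hT hg hmin
  rcases Nat.lt_or_ge g 4 with hlt | hge
  · obtain rfl : g = 3 := by omega
    have hDT := h₁ M e k T hT hmin
    rcases hW M e k T hT hDT with hwr | hΦ
    · exact hwr
    · obtain ⟨Φ⟩ := hΦ
      exact (not_minimalGenus_of_diffeomorph_sphere Φ (by norm_num) hmin).elim
  · exact h₂ M e g k T hT hge hmin

/-- **The route closes with `(W)` in place of X_F.**  Feeding
`dependentTripleGenusThreeStandard_of_isWeaklyReducible_or hW h4` for the hypothesis `hXF` of the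
route's deciding theorem `closes`, and the PROVED items `MinimalWeaklyReducibleOfRungs_proof`,
`TrisectionsExist_proof`, `SphereSumSphere_proof` for theirs, `SmoothPoincare4` follows from `(W)`,
the four cruxes / supports `DependentTripleAtThree`, `MinimalWeaklyReducibleFromFour`,
`WeakReductionReduces`, `ReducibleSplits` and the two base rungs `GenusThreeBase`, `LowGenusBase`.
So for the ROUTE the named-fact debt of X_F is `(W)` — Aranda–Zupan §7 read on top of Thm. 1.3 —
and not Thm. 1.4 whole.  Conditional on the listed hypotheses (D-0014); nothing is restated.
[cite: ArandaZupan2025, Thm. 1.3 and Thm. 1.4 (p. 2), §7 (pp. 25–26)] -/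
theorem smoothPoincare4_of_isWeaklyReducible_or
    (hW : ∀ (M : Type) [TopologicalSpace M] [T2Space M] [SecondCountableTopology M]
      [ChartedSpace (EuclideanSpace ℝ (Fin 4)) M] [IsManifold (𝓡 4) ((⊤ : ℕ∞) : WithTop ℕ∞) M],
      (M ≃ₕ (Metric.sphere (0 : EuclideanSpace ℝ (Fin 5)) 1)) → ∀ (k : Fin 3 → ℕ) (T : Fin 3 → Set M),
      IsGKTrisection M 3 k T →
      (∃ (a b c : Set M), IsCurve T a ∧ IsCurve T b ∧ IsCurve T c ∧ Disjoint a b ∧ Disjoint b c ∧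
        Disjoint a c ∧ IsNonSeparating T a ∧ IsNonSeparating T b ∧ IsNonSeparating T c ∧
        BoundsDisc T (spineHandlebody T 0) a ∧ BoundsDisc T (spineHandlebody T 1) b ∧
        BoundsDisc T (spineHandlebody T 2) c ∧
        ¬ IsPreconnected (centralSurfaceSet T \ (a ∪ b ∪ c))) →
      IsWeaklyReducible T ∨ Nonempty (Diffeomorph (𝓡 4) (𝓡 4) M
        (Metric.sphere (0 : EuclideanSpace ℝ (Fin 5)) 1) ((⊤ : ℕ∞) : WithTop ℕ∞)))
    (hX1 : DependentTripleAtThree) (hX2 : MinimalWeaklyReducibleFromFour)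
    (h2 : WeakReductionReduces) (h3 : ReducibleSplits) (h4 : GenusThreeBase) (h5 : LowGenusBase) :
    SmoothPoincare4 :=
  closes hX1 (dependentTripleGenusThreeStandard_of_isWeaklyReducible_or hW h4) hX2
    MinimalWeaklyReducibleOfRungs_proof h2 h3 h4 h5 TrisectionsExist_proof SphereSumSphere_proof

end Summit.SmoothPoincare4.SmoothPoincare4.Theorems
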